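/-
Origin: expansion seat `planner-pub-hodgecm-qw8-g11-0`, handover #19 SPLIT PART 2/2 = REPLACE tree `HodgeCM/Model/Toy/LefQuarticQuad.lean` 5e74bc2b (626 l.) by md5 0dcc83baeedbd919433b6d61de5bb6a0 (368 l.): keeps the module name + module docstring, its earlier sections moved verbatim to rows #18..#18 (LefQuarticQuadLift); ONE rewrite: `import Qw8g11.LefQuarticQuadLift` -> `import HodgeCM.Model.Toy.LefQuarticQuadLift` (row #18); union of the parts' comment-strip (`HOME/pub-hodgecm-qw8-g11/lean/Qw8g11/LefQuarticQuad.lean`, md5 0dcc83ba, 368 lines);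
landed by the packager successor (mc-unitary-1-g3, gen-8 kit) in gate run 32 REPLACES the earlier landed copy of `HodgeCM/Model/Toy/LefQuarticQuad.lean` (import ^import Qw8g11\.LefQuarticQuadLift[ \t]*$→import HodgeCM.Model.Toy.LefQuarticQuadLift ×1).
-/
-- HANDOVER (planner-pub-hodgecm-qw8-g11-0, unit pub-hodgecm-qw8-g11): SPLIT PART 2/2 = REPLACEMENT of the installed
-- `HodgeCM.Model.Toy.LefQuarticQuad` (md5 5e74bc2b, 626 l.): §§5–7 (ll. 318–622) verbatim + docstrings; §§1–4 moved to
-- `LefQuarticQuadLift`; at landing rewrite `import Qw8g11.LefQuarticQuadLift` ↦ `import HodgeCM.Model.Toy.LefQuarticQuadLift`.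
/-
Copyright (c) 2026. All rights reserved.
Released under Apache 2.0 license as described in the file LICENSE.
-/
import Summits.HodgeConjecture.HodgeCM.Model.Toy.LefQuarticQuadLift

/-!
# The Lefschetz model on products mixing ONE CM field of degree `≤ 4` with imaginary quadratic fields

(Split for the 400-line cap: §§1–4 of this file — the `Ω`-restricted homogeneity count, `Obj.glift`, `Obj.PresentedAt` and
the same-field pair orbit — are now the module `HodgeCM.Model.Toy.LefQuarticQuadLift`, imported here; §§5–7 below are
unchanged.)

`LefQuartic`: `lefModel ⊨ HC` on every object presented over ONE CM field `K` with `[K:ℚ] ≤ 4` (and on all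
of them iff `[K:ℚ] ≤ 4`).  `LefQuadMixed`: the same for objects whose atoms are presented over imaginary
quadratic fields varying from atom to atom.  This file glues the two: every object each of whose atoms is
presented EITHER over one fixed CM field `K` of degree `≤ 4` OR over some imaginary quadratic field
(`Obj.MixPresented K X`) satisfies `CntBal`, hence HC in `lefModel` (`lef_hc_of_mixPresented`); e.g.
`A × E₁ × ⋯ × Eₘ` for a CM abelian surface `A` with quartic CM and CM elliptic curves `Eⱼ` with arbitrary CM
fields (`lef_hc_prod_of_presented_of_quadPresented`).  Two different QUARTIC fields do not glue (reflex
sisters, see the `LefQuadMixed` docstring), so together with `LefQuartic`/`LefQuadMixed` this is the natural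
positive statement on the mixed side.

Method.  The pair sums `Σ_{ω ∈ Ω_X} sg(ω s) sg(ω t)` of `LefQuadMixed` §3 are pushed forward along
`ω ↦ (ω·x, ω·y)` to the finite PAIR ORBIT `O ⊆ Hom(K,ℂ) × Hom(k,ℂ)` of the two slots read in their
presenting fields (§§2–3; equal fibres by the group-free orbit–stabiliser count of `LefQuartic` §5, here in an
`Ω`-restricted form, §1).  For two `K`-slots the pair orbit is `LefQuartic`'s `pairSet`, and `TriInner K`
gives the trichotomy (§4).  For a `K`-slot against a `k`-slot, `k` imaginary quadratic (§5), `O` is homogeneous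
over both projections, its second projection is `{y, ȳ}`, and `(a,b) ↦ (ā,b̄)` swaps the two fibres without
changing the summand; so `Σ_O = 2·sgn(y)·S` with `S` a sum of `sgn_Ψ` over the `#O/2` first coordinates of
the fibre over `y` — a set of `[K:ℚ]/2` or `[K:ℚ]` embeddings of `K`; for `[K:ℚ] ≤ 4` such a sum is `0` or
`±` its number of terms.  (From degree `6` on a `3`-set of embeddings can have sign sum `±1`: the face
phenomenon again.)  Nothing is cited: kernel facts about an explicit model.
-/

noncomputable section

set_option backward.isDefEq.respectTransparency false

namespace HodgeCM.Toy

open scoped TensorProduct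
open exteriorPower Module CMPresentation CMTypeOps
open NumberField.ComplexEmbedding (conjugate)
open Literature.AlgebraicGeometry.Motives

namespace Obj

variable (X : Obj)

/-! ### 5. A `K`-slot against a `k`-slot, `[K:ℚ] ≤ 4`, `k` imaginary quadratic -/

section Kk

open scoped Classical

variable {K k : CMField}

/-- **the pair orbit of a `K`-slot and a `k`-slot** (`[K:ℚ] ≤ 4`, `[k:ℚ] = 2`): for
`O = {(γx, γy)} ⊆ Hom(K,ℂ) × Hom(k,ℂ)` and CM types `Ψ, Ψ'`,
`Σ_{(a,b) ∈ O} sgn_Ψ(a) sgn_Ψ'(b) ∈ {0, ±#O}`.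
`(a,b) ↦ (ā,b̄)` swaps the fibres over `y` and `ȳ` and fixes the summand, so the sum is twice
`sgn_Ψ'(y) · Σ_{a ∈ T} sgn_Ψ(a)`, `T` = first coordinates of the fibre over `y`, `#O = 2#T`; `O` is
homogeneous over the first projection (onto `Hom(K,ℂ)`, fibres of size `≤ 2`), so `#T ∈ {[K:ℚ]/2, [K:ℚ]}`,
i.e. `#T ≤ 2` or `T` is everything. -/
theorem trichot_pairOrbit (hK : Module.finrank ℚ K ≤ 4) (hk : Module.finrank ℚ k = 2) (Ψ : CMType K)
    (Ψ' : CMType k) (x : K →+* ℂ) (y : k →+* ℂ) (O : Finset ((K →+* ℂ) × (k →+* ℂ)))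
    (hO : ∀ q, q ∈ O ↔ ∃ γ : Gam, (twist γ x, twist γ y) = q) :
    Trichot O.card (∑ q ∈ O, sgn Ψ q.1 * sgn Ψ' q.2) := by
  have hxy : (x, y) ∈ O := (hO _).mpr ⟨1, by rw [twist_one, twist_one]⟩
  -- conjugation on `O`
  have hconjO : ∀ q ∈ O, (conjugate q.1, conjugate q.2) ∈ O := by
    intro q hq
    obtain ⟨γ, rfl⟩ := (hO q).mp hq
    exact (hO _).mpr ⟨Obj.kap * γ, by rw [twist_mul, twist_mul, twist_kap, twist_kap]⟩
  have hsnd : ∀ q ∈ O, q.2 = y ∨ q.2 = conjugate y := fun q _ => eq_or_of_finrank_eq_two Ψ' hk y q.2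
  have hyne : conjugate y ≠ y := conjugate_ne_self_of_cmType Ψ' y
  -- the two fibres over `y` and `ȳ` are swapped by conjugation
  have hi : ∀ q ∈ O.filter (fun q => ¬ q.2 = y),
      (conjugate q.1, conjugate q.2) ∈ O.filter (fun q => q.2 = y) := by
    intro q hq
    rw [Finset.mem_filter] at hq ⊢
    refine ⟨hconjO q hq.1, ?_⟩
    rcases hsnd q hq.1 with h2 | h2
    · exact absurd h2 hq.2
    · show conjugate q.2 = y
      rw [h2, conjugate_conjugate]
  have hj : ∀ q ∈ O.filter (fun q => q.2 = y),
      (conjugate q.1, conjugate q.2) ∈ O.filter (fun q => ¬ q.2 = y) := by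
    intro q hq
    rw [Finset.mem_filter] at hq ⊢
    refine ⟨hconjO q hq.1, ?_⟩
    show ¬ conjugate q.2 = y
    rw [hq.2]
    exact hyne
  have hinv : ∀ q : (K →+* ℂ) × (k →+* ℂ),
      (conjugate (conjugate q.1, conjugate q.2).1, conjugate (conjugate q.1, conjugate q.2).2) = q :=
    fun q => by rw [conjugate_conjugate, conjugate_conjugate]
  have hswap : ∑ q ∈ O.filter (fun q => ¬ q.2 = y), sgn Ψ q.1 * sgn Ψ' q.2
      = ∑ q ∈ O.filter (fun q => q.2 = y), sgn Ψ q.1 * sgn Ψ' q.2 := by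
    refine Finset.sum_nbij' (fun q => (conjugate q.1, conjugate q.2))
      (fun q => (conjugate q.1, conjugate q.2)) hi hj (fun q _ => hinv q) (fun q _ => hinv q) ?_
    intro q _
    show sgn Ψ q.1 * sgn Ψ' q.2 = sgn Ψ (conjugate q.1) * sgn Ψ' (conjugate q.2)
    rw [sgn_conjugate, sgn_conjugate]
    ring
  have hcard2 : O.card = 2 * (O.filter (fun q => q.2 = y)).card := by
    rw [← Finset.card_filter_add_card_filter_not (fun q => q.2 = y), two_mul]
    congr 1
    exact Finset.card_nbij' (fun q => (conjugate q.1, conjugate q.2))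
      (fun q => (conjugate q.1, conjugate q.2)) (fun q hq => hi q hq) (fun q hq => hj q hq)
      (fun q _ => hinv q) (fun q _ => hinv q)
  -- `T` : first coordinates of the fibre over `y`
  have hinjfst : Set.InjOn Prod.fst (O.filter (fun q => q.2 = y) : Set ((K →+* ℂ) × (k →+* ℂ))) := by
    intro q hq q' hq' h1
    rw [Finset.mem_coe, Finset.mem_filter] at hq hq'
    exact Prod.ext h1 (by rw [hq.2, hq'.2])
  have hcardT : ((O.filter (fun q => q.2 = y)).image Prod.fst).card = (O.filter (fun q => q.2 = y)).card :=
    Finset.card_image_of_injOn hinjfst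
  have hsumT : ∑ q ∈ O.filter (fun q => q.2 = y), sgn Ψ q.1 * sgn Ψ' q.2
      = sgn Ψ' y * ∑ a ∈ (O.filter (fun q => q.2 = y)).image Prod.fst, sgn Ψ a := by
    rw [Finset.sum_image fun q hq q' hq' h => hinjfst hq hq' h, Finset.mul_sum]
    refine Finset.sum_congr rfl fun q hq => ?_
    rw [Finset.mem_filter] at hq
    rw [hq.2, mul_comm]
  -- the first projection: homogeneous with image everything and fibres of size `≤ 2`
  have hmaps : ∀ γ : Gam, ∀ q ∈ O, Prod.map (twist γ) (twist γ) q ∈ O := by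
    intro γ q hq
    obtain ⟨δ, rfl⟩ := (hO q).mp hq
    exact (hO _).mpr ⟨γ * δ, by rw [Prod.map_apply, twist_mul, twist_mul]⟩
  have hinjm : ∀ γ : Gam, Function.Injective (Prod.map (twist γ) (twist γ) :
      (K →+* ℂ) × (k →+* ℂ) → (K →+* ℂ) × (k →+* ℂ)) :=
    fun γ => (twist_injective γ).prodMap (twist_injective γ)
  have htrans : ∀ q ∈ O, ∀ q' ∈ O, ∃ γ : Gam, Prod.map (twist γ) (twist γ) q = q' := by
    intro q hq q' hq'
    obtain ⟨δ, rfl⟩ := (hO q).mp hq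
    obtain ⟨δ', rfl⟩ := (hO q').mp hq'
    refine ⟨δ' * δ.symm, ?_⟩
    change (twist (δ' * δ.symm) (twist δ x), twist (δ' * δ.symm) (twist δ y)) = _
    rw [twist_mul, twist_symm_twist, twist_mul, twist_symm_twist]
  have himfst : O.image Prod.fst = Finset.univ :=
    Finset.eq_univ_of_forall fun a => by
      obtain ⟨γ, hγ⟩ := exists_twist_eq x a
      exact Finset.mem_image.mpr ⟨_, (hO _).mpr ⟨γ, rfl⟩, hγ⟩
  have hcard1 : O.card = (O.filter (fun q => q.1 = x)).card * Fintype.card (K →+* ℂ) := by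
    have key := card_eq_card_fibre_mul hmaps hinjm htrans (F := Prod.fst) (act := twist)
      (fun _ _ => rfl) hxy
    rw [himfst, Finset.card_univ] at key
    exact key
  have hf1 : (O.filter (fun q => q.1 = x)).card ≤ 2 := by
    have h := Finset.card_le_card_of_injOn Prod.snd (fun q _ => Finset.mem_coe.mpr (Finset.mem_univ q.2))
      (s := O.filter (fun q => q.1 = x)) (t := (Finset.univ : Finset (k →+* ℂ))) (by
        intro q hq q' hq' h2
        rw [Finset.mem_coe, Finset.mem_filter] at hq hq'
        exact Prod.ext (by rw [hq.2, hq'.2]) h2)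
    rwa [Finset.card_univ, NumberField.Embeddings.card k ℂ, hk] at h
  have hf1' : 1 ≤ (O.filter (fun q => q.1 = x)).card :=
    Finset.card_pos.mpr ⟨(x, y), Finset.mem_filter.mpr ⟨hxy, rfl⟩⟩
  -- so `T` has at most two elements or is everything
  have hT : ((O.filter (fun q => q.2 = y)).image Prod.fst).card ≤ 2
      ∨ (O.filter (fun q => q.2 = y)).image Prod.fst = Finset.univ := by
    rcases finrank_eq_two_or_eq_four_of_le_four K hK with h2 | h4
    · left
      calc ((O.filter (fun q => q.2 = y)).image Prod.fst).card
          ≤ (Finset.univ : Finset (K →+* ℂ)).card := Finset.card_le_card (Finset.subset_univ _)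
        _ = 2 := by rw [Finset.card_univ, NumberField.Embeddings.card K ℂ, h2]
    · rw [NumberField.Embeddings.card K ℂ, h4] at hcard1
      have hTc : ((O.filter (fun q => q.2 = y)).image Prod.fst).card
          = 2 * (O.filter (fun q => q.1 = x)).card := by
        rw [hcardT]; omega
      rcases Nat.lt_or_ge (O.filter (fun q => q.1 = x)).card 2 with hl | hl
      · left; omega
      · right
        apply Finset.eq_univ_of_card
        rw [hTc, NumberField.Embeddings.card K ℂ, h4]
        omega
  have hTri : Trichot ((O.filter (fun q => q.2 = y)).image Prod.fst).card
      (∑ a ∈ (O.filter (fun q => q.2 = y)).image Prod.fst, sgn Ψ a) := by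
    rcases hT with hT | hT
    · exact trichot_sum_sgn_of_card_le_two Ψ _ hT
    · rw [hT]; exact trichot_sum_sgn_univ Ψ
  -- assemble: `Σ_O = 2 · sgn(y) · Σ_T`, `#O = 2 · #T`
  have hsumO : ∑ q ∈ O, sgn Ψ q.1 * sgn Ψ' q.2
      = 2 * (sgn Ψ' y * ∑ a ∈ (O.filter (fun q => q.2 = y)).image Prod.fst, sgn Ψ a) := by
    rw [← Finset.sum_filter_add_sum_filter_not O (fun q => q.2 = y), hswap, ← two_mul, hsumT]
  rw [hsumO, hcard2, ← hcardT]
  have hTri' : Trichot ((O.filter (fun q => q.2 = y)).image Prod.fst).card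
      (sgn Ψ' y * ∑ a ∈ (O.filter (fun q => q.2 = y)).image Prod.fst, sgn Ψ a) := by
    rcases sgn_eq_or Ψ' y with h1 | h1
    · rw [h1, one_mul]; exact hTri
    · rw [h1, neg_one_mul]; exact Trichot.neg_iff.mpr hTri
  have := hTri'.mul 2
  push_cast at this
  exact this

/-- **a `K`-slot against a `k`-slot**: the pair sum over `Ω_X` is a positive multiple of the sum over the
pair orbit of the two slots read in `K` resp. `k`, so `trichot_pairOrbit` gives the trichotomy. -/
theorem trichot_of_presentedAt_of_quad (hK : Module.finrank ℚ K ≤ 4) (hk : Module.finrank ℚ k = 2)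
    {s t : X.Idx} (hs : X.PresentedAt K s.1) (ht : X.PresentedAt k t.1) :
    Trichot X.Omega.card (∑ ω ∈ X.Omega, X.sg (ω s) * X.sg (ω t)) := by
  obtain ⟨i, τ⟩ := s
  obtain ⟨i', τ'⟩ := t
  obtain ⟨Ψ, e, he⟩ := hs
  obtain ⟨Ψ', e', he'⟩ := ht
  obtain ⟨x, hx⟩ : ∃ x : K →+* ℂ, x = τ.comp e := ⟨_, rfl⟩
  obtain ⟨y, hy⟩ : ∃ y : k →+* ℂ, y = τ'.comp e' := ⟨_, rfl⟩
  obtain ⟨P, hP⟩ : ∃ P : (X.Idx → X.Idx) → (K →+* ℂ) × (k →+* ℂ),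
      ∀ ω, P ω = (twist (X.glift ω) x, twist (X.glift ω) y) := ⟨_, fun _ => rfl⟩
  obtain ⟨h, hh⟩ : ∃ h : (K →+* ℂ) × (k →+* ℂ) → ℤ, ∀ q, h q = sgn Ψ q.1 * sgn Ψ' q.2 :=
    ⟨_, fun _ => rfl⟩
  have hsum : ∑ ω ∈ X.Omega, X.sg (ω ⟨i, τ⟩) * X.sg (ω ⟨i', τ'⟩) = ∑ ω ∈ X.Omega, h (P ω) :=
    Finset.sum_congr rfl fun ω hω => by
      rw [hh, hP, X.sg_eq_sgn_twist_glift he hω, X.sg_eq_sgn_twist_glift he' hω, hx, hy]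
  have hF : ∀ γ : Gam, ∀ ω ∈ X.Omega,
      P (fun s => X.gact γ (ω s)) = Prod.map (twist γ) (twist γ) (P ω) := by
    intro γ ω hω
    rw [hP, hP, Prod.map_apply, hx, hy, X.twist_glift_comp γ hω, X.twist_glift_comp γ hω]
  have hO : ∀ q, q ∈ X.Omega.image P ↔ ∃ γ : Gam, (twist γ x, twist γ y) = q := by
    intro q
    rw [Finset.mem_image]
    constructor
    · rintro ⟨ω, hω, rfl⟩
      obtain ⟨δ, rfl⟩ := mem_Omega.mp hω
      exact ⟨δ, by rw [hP, hx, hy, twist_glift_gact, twist_glift_gact]⟩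
    · rintro ⟨γ, rfl⟩
      exact ⟨X.gact γ, X.gact_mem_Omega γ, by rw [hP, hx, hy, twist_glift_gact, twist_glift_gact]⟩
  have h1 := X.gact_mem_Omega 1
  have key := sum_eq_card_fibre_mul_sum' (X.Omega_mapsTo) (X.comp_gact_injective) (X.Omega_transitive)
    hF h h1
  have keyc := card_eq_card_fibre_mul' (X.Omega_mapsTo) (X.comp_gact_injective) (X.Omega_transitive)
    hF h1
  have hpair : Trichot (X.Omega.image P).card (∑ q ∈ X.Omega.image P, h q) := by
    have h3 : ∑ q ∈ X.Omega.image P, h q = ∑ q ∈ X.Omega.image P, sgn Ψ q.1 * sgn Ψ' q.2 :=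
      Finset.sum_congr rfl fun q _ => hh q
    rw [h3]
    exact trichot_pairOrbit hK hk Ψ Ψ' x y _ hO
  rw [hsum, key, keyc]
  exact hpair.mul _

end Kk

/-! ### 6. Mixed data: one CM field of degree `≤ 4` together with imaginary quadratic fields -/

section Mixed

variable (K : CMField)

/-- every atom of `X` is presented over `K`, or over some imaginary quadratic field -/
def MixPresented : Prop :=
  ∀ i, X.PresentedAt K i ∨ X.QuadPresentedAt i

variable {K} {X}

/-- an object presented over `K` is mixed-presented over `K` -/
theorem mixPresented_of_presented (h : X.Presented K) : X.MixPresented K :=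
  fun i => Or.inl (presentedAt_of_presented h i)

/-- a quadratic-presented object is mixed-presented over any `K` -/
theorem mixPresented_of_quadPresented (h : X.QuadPresented) : X.MixPresented K :=
  fun i => Or.inr (h i)

/-- `MixPresented K` is preserved by the product `X.prod Y` -/
theorem mixPresented_prod {X Y : Obj} (hX : X.MixPresented K) (hY : Y.MixPresented K) :
    (X.prod Y).MixPresented K := by
  rintro (i | i)
  · exact hX i
  · exact hY i

/-- `MixPresented K` is preserved by the iterated product `prodFin` of `toyModelWith D` -/
theorem mixPresented_prodFin (D : HodgeData) : ∀ (n : ℕ) (Xs : Fin (n + 1) → Obj),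
    (∀ j, (Xs j).MixPresented K) → Obj.MixPresented ((toyModelWith D).prodFin n Xs) K
  | 0, _, h => h 0
  | n + 1, _, h => mixPresented_prod (mixPresented_prodFin D n _ fun _ => h _) (h _)

open scoped Classical in
/-- **the trichotomy for mixed data**: `[K:ℚ] ≤ 4` and every atom presented over `K` or over an imaginary
quadratic field ⇒ every pair sum over `Ω_X` is `0` or `±#Ω_X`. The four cases: two `K`-slots
(`trichot_of_presentedAt` + `LefQuartic`'s `TriInner K`), a `K`-slot against a quadratic slot either way round
(`trichot_of_presentedAt_of_quad`), two quadratic slots (`LefQuadMixed`'s sign characters). -/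
theorem triOmega_of_mixPresented (hK : Module.finrank ℚ K ≤ 4) (h : X.MixPresented K) : X.TriOmega := by
  intro s t
  have hT : TriInner K := by
    rcases finrank_eq_two_or_eq_four_of_le_four K hK with h2 | h4
    · exact triInner_of_finrank_eq_two K h2
    · exact triInner_of_finrank_eq_four K h4
  rcases h s.1 with hs | hs <;> rcases h t.1 with ht | ht
  · exact X.trichot_of_presentedAt hT hs ht
  · obtain ⟨k, hk, ht⟩ := presentedAt_of_quadPresentedAt ht
    exact X.trichot_of_presentedAt_of_quad hK hk hs ht
  · obtain ⟨k, hk, hs⟩ := presentedAt_of_quadPresentedAt hs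
    have h' := X.trichot_of_presentedAt_of_quad hK hk ht hs
    have heq : ∑ ω ∈ X.Omega, X.sg (ω s) * X.sg (ω t) = ∑ ω ∈ X.Omega, X.sg (ω t) * X.sg (ω s) :=
      Finset.sum_congr rfl fun ω _ => mul_comm _ _
    rw [heq]
    exact h'
  · exact X.trichot_of_signCharAt (X.signCharAt_of_quadPresentedAt hs) (X.signCharAt_of_quadPresentedAt ht)

/-- **Balance for mixed data.** If `[K:ℚ] ≤ 4`, every object each of whose atoms is presented over
`K` or over some imaginary quadratic field satisfies `CntBal` -/
theorem cntBal_of_mixPresented (hK : Module.finrank ℚ K ≤ 4) (h : X.MixPresented K) : X.CntBal :=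
  X.cntBal_of_triOmega (triOmega_of_mixPresented hK h)

end Mixed

end Obj

/-! ### 7. Headlines -/

section Headline

variable (K : CMField)

/-- **HC in the Lefschetz model for mixed CM data**: `[K:ℚ] ≤ 4` and every atom of `X` presented over `K` or
over an imaginary quadratic field (any shape, any number of factors, arbitrary CM fields `Fᵢ` of the atoms,
arbitrary `extra`) ⇒ every Hodge class on `X` is `lefModel`-algebraic. -/
theorem lef_hc_of_mixPresented (hK : Module.finrank ℚ K ≤ 4) (X : Obj) (h : X.MixPresented K) :
    lefModel.HC X :=
  lef_hc_of_cntBal X (Obj.cntBal_of_mixPresented hK h)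

/-- … on iterated products of such objects … -/
theorem lef_hc_prodFin_of_mixPresented (hK : Module.finrank ℚ K ≤ 4) {n : ℕ} (Xs : Fin (n + 1) → Obj)
    (h : ∀ j, (Xs j).MixPresented K) : lefModel.HC (lefModel.prodFin n Xs) := by
  rw [lefModel_prodFin]
  exact lef_hc_of_mixPresented K hK _ (Obj.mixPresented_prodFin exteriorHodgeData n Xs h)

/-- **HEADLINE.** `lefModel ⊨ HC` on every product of CM abelian varieties `A_{(F₀,Θ₀)} × ⋯ × A_{(Fₙ,Θₙ)}`
each of whose CM types `Θⱼ` is induced EITHER from a CM type of ONE fixed CM field `K` with `[K:ℚ] ≤ 4` OR from a CM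
type of SOME imaginary quadratic field `kⱼ` (varying with `j`), along arbitrary embeddings into the CM fields
`Fⱼ` (arbitrary dimensions `[Fⱼ:ℚ]/2`). This is the union of `LefQuartic`'s one-field theorem
(`lef_hc_prodFin_induceType`) and `LefQuadMixed`'s mixed-quadratic theorem (`lef_hc_prodFin_induceType_quad`);
two DIFFERENT quartic fields are not allowed (and cannot be: see the module docstring). -/
theorem lef_hc_prodFin_cmObj_mixed (hK : Module.finrank ℚ K ≤ 4) {n : ℕ} (F : Fin (n + 1) → CMField)
    (Θ : ∀ j, CMType (F j))
    (h : ∀ j, (∃ (Ψ : CMType K) (e : K →+* F j), Θ j = induceType e Ψ) ∨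
      (∃ (k : CMField) (_ : Module.finrank ℚ k = 2) (Ψ : CMType k) (e : k →+* F j), Θ j = induceType e Ψ)) :
    lefModel.HC (lefModel.prodFin n fun j => cmObj (F j) (Θ j)) := by
  refine lef_hc_prodFin_of_mixPresented K hK _ fun j => ?_
  rcases h j with ⟨Ψ, e, hΘ⟩ | ⟨k, hk, Ψ, e, hΘ⟩
  · rw [hΘ]
    exact Obj.mixPresented_of_presented (presented_cmObj_induceType K e Ψ)
  · rw [hΘ]
    exact Obj.mixPresented_of_quadPresented (quadPresented_cmObj_induceType k hk e Ψ)

/-- … e.g. `A_{(K,Φ₀)} × ⋯ × A_{(K,Φₘ)} × A_{(k₀,Ψ₀)} × ⋯`-type data given as one family: CM objects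
over `K` itself and over imaginary quadratic fields themselves. -/
theorem lef_hc_prodFin_cmObj_mixed' (hK : Module.finrank ℚ K ≤ 4) {n : ℕ} (F : Fin (n + 1) → CMField)
    (Θ : ∀ j, CMType (F j)) (h : ∀ j, F j = K ∨ Module.finrank ℚ (F j) = 2) :
    lefModel.HC (lefModel.prodFin n fun j => cmObj (F j) (Θ j)) := by
  refine lef_hc_prodFin_of_mixPresented K hK _ fun j => ?_
  rcases h j with hj | hj
  · subst hj
    exact Obj.mixPresented_of_presented (presented_cmObj (F j) (Θ j))
  · exact Obj.mixPresented_of_quadPresented (quadPresented_cmObj (F j) hj (Θ j))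

/-- the two-factor form: `X` presented over `K` (`[K:ℚ] ≤ 4`), `Y` with imaginary-quadratic atoms -/
theorem lef_hc_prod_of_presented_of_quadPresented (hK : Module.finrank ℚ K ≤ 4) {X Y : Obj}
    (hX : X.Presented K) (hY : Y.QuadPresented) : lefModel.HC (X.prod Y) :=
  lef_hc_of_mixPresented K hK _
    (Obj.mixPresented_prod (Obj.mixPresented_of_presented hX) (Obj.mixPresented_of_quadPresented hY))

end Headline

end HodgeCM.Toy

end
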